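import Literature.NumberTheory.EllipticCurves.NeronModel

/-!
# Sanity lemmas for the pub-residmod REVIEW-RUNBOOK (cards `genericFibre`, `specGenericPoint`)

Review evidence only (ops-runbook sanity registry `registry/pub-residmod.json`); no new definitions, no new
mathematics.  The two `abbrev`s of `Literature/NumberTheory/EllipticCurves/NeronModel.lean` that enter the
statement closure of `Summit.Ventures.ResidMod.modular_of_mod2RowNOS` through `IsAbelianSchemeModel`
(good reduction) had no lemma naming them anywhere in the tree:

* (a) AGREEMENT with the Mathlib notion: `genericFibre R K` is, on the nose, Mathlib's base-change functor
  `CategoryTheory.Over.pullback` along the generic point `Spec K → Spec R`, and that generic point is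
  `Spec.map (algebraMap R K)`; on objects the generic fibre of `𝒳 → Spec R` is the fibre product
  `𝒳 ×_{Spec R} Spec K` with the second projection as structure morphism (BLR, *Néron Models*, §1.2).
* (b) NON-VACUITY / expected values: the generic fibre of the base `Spec R` itself is `Spec K` (its structure
  morphism is an isomorphism), and in the degenerate case `R = K` the generic point is an isomorphism.
-/

noncomputable section

namespace Summit.Ventures.ResidMod.Runbook

open AlgebraicGeometry CategoryTheory CategoryTheory.Limits
open Literature.NumberTheory.EllipticCurves

universe u

variable (R : Type u) [CommRing R] (K : Type u) [Field K] [Algebra R K]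

/-- (a) `specGenericPoint R K` is the morphism of affine schemes `Spec K → Spec R` induced by the structure map
`algebraMap R K` (definitional). -/
theorem specGenericPoint_eq_spec_map :
    specGenericPoint R K = Spec.map (CommRingCat.ofHom (algebraMap R K)) := rfl

/-- (a) agreement with Mathlib: the generic-fibre functor IS `Over.pullback` (base change) along the generic
point (definitional). -/
theorem genericFibre_eq_over_pullback :
    genericFibre R K = Over.pullback (specGenericPoint R K) := rfl

/-- (a) on objects: the underlying scheme of the generic fibre of `𝒳 → Spec R` is Mathlib's chosen fibre
product `𝒳 ×_{Spec R} Spec K` (`pullback 𝒳.hom (Spec K → Spec R)`). -/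
theorem genericFibre_obj_left (𝒳 : Over (Spec (.of R))) :
    ((genericFibre R K).obj 𝒳).left = pullback 𝒳.hom (specGenericPoint R K) := rfl

/-- (a) on objects: the structure morphism of the generic fibre `𝒳_K → Spec K` is the second projection of
the fibre product. -/
theorem genericFibre_obj_hom (𝒳 : Over (Spec (.of R))) :
    ((genericFibre R K).obj 𝒳).hom = pullback.snd 𝒳.hom (specGenericPoint R K) := rfl

/-- (a) on morphisms: the generic fibre `f_K` of an `R`-morphism `f : 𝒳 → 𝒴` is the map of fibre products that is
`f.left` on the first factor … -/
theorem genericFibre_map_left_fst {𝒳 𝒴 : Over (Spec (.of R))} (f : 𝒳 ⟶ 𝒴) :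
    ((genericFibre R K).map f).left ≫ pullback.fst 𝒴.hom (specGenericPoint R K) =
      pullback.fst 𝒳.hom (specGenericPoint R K) ≫ f.left := by
  exact pullback.lift_fst _ _ _

/-- … and the identity on the factor `Spec K` (it commutes with the second projections). -/
theorem genericFibre_map_left_snd {𝒳 𝒴 : Over (Spec (.of R))} (f : 𝒳 ⟶ 𝒴) :
    ((genericFibre R K).map f).left ≫ pullback.snd 𝒴.hom (specGenericPoint R K) =
      pullback.snd 𝒳.hom (specGenericPoint R K) := by
  exact pullback.lift_snd _ _ _

/-- (b) expected value on the base: the generic fibre of `Spec R` (the terminal `R`-scheme `𝟙 (Spec R)`) is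
`Spec K` — its structure morphism `(Spec R)_K → Spec K` is an isomorphism (base change of an isomorphism). -/
theorem isIso_genericFibre_base_hom :
    IsIso ((genericFibre R K).obj (Over.mk (𝟙 (Spec (.of R))))).hom := by
  change IsIso (pullback.snd (𝟙 (Spec (.of R))) (specGenericPoint R K))
  infer_instance

/-- (b) degenerate case `R = K` (a field is its own fraction field): the generic point `Spec K → Spec K` is the
identity, in particular an isomorphism. -/
theorem specGenericPoint_self : specGenericPoint K K = 𝟙 (Spec (.of K)) := by
  change Spec.map (CommRingCat.ofHom (RingHom.id K)) = _
  rw [CommRingCat.ofHom_id, Spec.map_id]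

/-- (b) hence for `R = K` the generic point is an isomorphism. -/
theorem isIso_specGenericPoint_self : IsIso (specGenericPoint K K) := by
  rw [specGenericPoint_self]
  infer_instance

end Summit.Ventures.ResidMod.Runbook

end
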